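import Mathlib
import HarnessLib
import Summits.HubbardSuperconductivity.HubbardSuperconductivity.Theorems.KLProgrammeKLRegimeBetaSplitV17F2Variation
import Summits.HubbardSuperconductivity.HubbardSuperconductivity.Theorems.KLProgrammeKLRegimeSplitQuarticValueVariation

/-!
# Route `KLProgramme` — crux K3 gen 8, CHILD 1 (stmt-HubbardSuperconductivity-20438) in scheme F-II: the NAME of the (B1-V) package —
# `PairVariationAtV17F` (the all-scales Riccati comparison law + the `U`-currency total variation of the Cooper-ball pair amplitudes), with its three doors

Cell gate-hubbard-kl, seat hubbard-kl-k3c1-p1 (g19; child-1 lineage; technique «composed-map remainder propagation»).  Pen g25 (R386)(A): «YES (optional, tree-only, 0 registry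
cost) to the reviewed `…Defs` predicate `PairVariationAtV17F` NAMING (B1-V) — k3c2-p3's (T2) and any E1 producer can key on the name»; «NO» to any motion of the registered split
slot (the registered bundle `klPredsV17F2` and `BetaSplitAtV17F` are UNTOUCHED; this predicate is a tree-side name, not a slot).  (B1-V) is the package delivered by
`pairArrayVariation_of_edgeClauses_explicit` (`…SplitFlowPairArrayVariation`, p702548) under child 1's edge clauses and handed to the slot hypothesis of
`betaSplitP_of_slotsV17F2_variation` (`…BetaSplitV17F2Variation`, p703760) with the sign-defect allowance `2·klEdge`:

**`PairVariationAtV17F L M G P Q β U μ n`** — for every total momentum `Qm`, ONE comparison sequence `u : ℕ → ℝ` with signed cascade masses `W, m : ℕ → ℝ` such that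
(law) `u 0 = U`, `u (i+1) = u i/(1 + W i·u i)`; (masses) `|W i| ≤ m i ≤ bhi`; (sign defect, edge-localised) `m i − W i ≤ 2·klEdge G (i+1) |Qm|_𝕋` at every in-class step `i < n`;
(freezing) `W i = m i = 0` past the class exit or past `n`; (negative-mass line) `16·U·Σ_{i<n}(m i − W i) ≤ 1`; (quasi-monotonicity) `u j ≤ u i + (16U/15)²·Σ_{l∈[i,j)}(m l − W l)`,
`i ≤ j ≤ n`; (variation of `u`) `Σ_{i<n}|u (i+1) − u i| ≤ (257/225)·U`; (envelope = (B1-F) at EVERY `j ≤ n` with the common witness) `0 ≤ u j ≤ 2|U|`,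
`‖𝒞_j[K_j](Qm;k,k′) − u j‖ ≤ (C_W + klLegKappa·CR·Klam³)·U²` on `klBall L μ 0`; (variation of the amplitudes) `Σ_{i<n}‖𝒞_{i+1}[K_{i+1}](Qm;k,k′) − 𝒞_i[K_i](Qm;k,k′)‖ ≤ (11/9)·U + (C_W + klLegKappa·CR·Klam³)·U²`.

Doors (bookkeeping only): **`PairVariationAtV17F.pairArrayAtV17F`** (it refines the registered (B1-F) `PairArrayAtV17F … j` at every `j ≤ n`), **`PairVariationAtV17F.quarticValue_variation`**
(the amplitude variation keyed on `klQuarticValue … 0 1 k₁ k₂ k₃`, legs `k₁ k₂` on the ball, `k₃` free, via `klka_quarticValue_eq_pairAmplitude`), and the closer restated on the name,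
**`betaSplitP_of_slotsV17F2_pairVariation`** (`hs : BetaSplitAtV17F … n → PairVariationAtV17F … n → Pr.split …` ⟹ `BetaSplitP Pr W`).  A definition with a body + three one-line
theorems; nothing about the model is asserted; nothing asserts superconductivity.  0 kit.
-/

noncomputable section

namespace Summit.HubbardSuperconductivity.HubbardSuperconductivity.Theorems.KLRegimeSplit

set_option linter.dupNamespace false -- summit = problem name (single-conjunct summit), D-0017

open Real Finset Literature.MathematicalPhysics.QuantumLattice Literature.Probability.LatticeModels
open Summit.HubbardSuperconductivity.HubbardSuperconductivity.Theorems.KLProgrammeLegKernels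
open Summit.HubbardSuperconductivity.HubbardSuperconductivity.Theorems.CooperChannelRiccatiFlow

section Model

variable (L M : ℕ) [NeZero L] [NeZero M]

/-- **(B1-V) `PairVariationAtV17F L M G P Q β U μ n`** — per total momentum ONE Riccati comparison sequence for the whole history with its signed cascade masses: exact
repulsive law, mass bounds, edge-localised sign defect, freezing past the class exit, the negative-mass line, quasi-monotonicity, `U`-currency variation of the sequence, the
(B1-F) envelope at EVERY scale `j ≤ n`, and the `U`-currency total variation across scales of the Cooper-ball pair amplitudes.  See the module docstring. -/
def PairVariationAtV17F (G : GeoConsts) (P : SplitConsts) (Q : EngConsts) (β U μ : ℝ) (n : ℕ) : Prop :=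
  ∀ Qm : TorusSite 2 L, ∃ u W m : ℕ → ℝ, u 0 = U ∧ (∀ i, u (i + 1) = u i / (1 + W i * u i)) ∧
    (∀ i, |W i| ≤ m i ∧ m i ≤ G.bhi) ∧
    (∀ i < n, IsPairClassAt L Qm (i + 1) → m i - W i ≤ 2 * klEdge G (i + 1) (klTorusNorm L Qm)) ∧
    (∀ i, (n ≤ i ∨ ¬ IsPairClassAt L Qm (i + 1)) → W i = 0 ∧ m i = 0) ∧
    16 * U * ∑ i ∈ range n, (m i - W i) ≤ 1 ∧
    (∀ i j, i ≤ j → j ≤ n → u j ≤ u i + (16 / 15 * U) ^ 2 * ∑ l ∈ Ico i j, (m l - W l)) ∧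
    ∑ i ∈ range n, |u (i + 1) - u i| ≤ 257 / 225 * U ∧
    (∀ j ≤ n, 0 ≤ u j ∧ u j ≤ 2 * |U| ∧ ∀ k ∈ klBall L μ 0, ∀ k' ∈ klBall L μ 0,
      ‖klPairAmplitude L M β U μ (klFlowFrameU L M β U μ j) j Qm k k' - (u j : ℂ)‖ ≤ (P.C_W + klLegKappa * Q.CR * P.Klam ^ 3) * U ^ 2) ∧
    ∀ k ∈ klBall L μ 0, ∀ k' ∈ klBall L μ 0,
      ∑ i ∈ range n, ‖klPairAmplitude L M β U μ (klFlowFrameU L M β U μ (i + 1)) (i + 1) Qm k k' -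
          klPairAmplitude L M β U μ (klFlowFrameU L M β U μ i) i Qm k k'‖ ≤
        11 / 9 * U + (P.C_W + klLegKappa * Q.CR * P.Klam ^ 3) * U ^ 2

variable {L M}

/-- (B1-V) refines the registered (B1-F): `PairVariationAtV17F … n` gives `PairArrayAtV17F … j` at every `j ≤ n` (the common witness `u j` serves as the per-scale one). -/
theorem PairVariationAtV17F.pairArrayAtV17F {G : GeoConsts} {P : SplitConsts} {Q : EngConsts} {β U μ : ℝ} {n : ℕ}
    (h : PairVariationAtV17F L M G P Q β U μ n) {j : ℕ} (hj : j ≤ n) : PairArrayAtV17F L M P Q β U μ j := by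
  intro Qm
  obtain ⟨u, W, m, -, -, -, -, -, -, -, -, henv, -⟩ := h Qm
  obtain ⟨h0, h2, hd⟩ := henv j hj
  exact ⟨u j, h0, h2, hd⟩

/-- The amplitude-variation clause of (B1-V) keyed on the quartic `↑↓` values with two legs on the ball and the third leg free. -/
theorem PairVariationAtV17F.quarticValue_variation {G : GeoConsts} {P : SplitConsts} {Q : EngConsts} {β U μ : ℝ} {n : ℕ}
    (h : PairVariationAtV17F L M G P Q β U μ n) {k₁ k₂ : TorusSite 2 L} (hk₁ : k₁ ∈ klBall L μ 0) (hk₂ : k₂ ∈ klBall L μ 0) (k₃ : TorusSite 2 L) :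
    ∑ i ∈ range n, ‖klQuarticValue L M β U μ (klFlowFrameU L M β U μ (i + 1)) (i + 1) 0 1 k₁ k₂ k₃ -
        klQuarticValue L M β U μ (klFlowFrameU L M β U μ i) i 0 1 k₁ k₂ k₃‖ ≤
      11 / 9 * U + (P.C_W + klLegKappa * Q.CR * P.Klam ^ 3) * U ^ 2 := by
  obtain ⟨u, W, m, -, -, -, -, -, -, -, -, -, htv⟩ := h (k₁ + k₃)
  simp only [klka_quarticValue_eq_pairAmplitude]
  exact htv k₂ hk₂ k₁ hk₁

end Model

/-- **Child 1 at slot level for every bundle whose split slot is implied by `BetaSplitAtV17F ∧ PairVariationAtV17F`** — `betaSplitP_of_slotsV17F2_variation` restated on the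
name (the registered bundle `klPredsV17F2`, whose split slot ignores (B1-V), is the special case `betaSplitP_klPredsV17F2`). -/
theorem betaSplitP_of_slotsV17F2_pairVariation {Pr : Preds} {W : Set ℝ}
    (hs : ∀ (L M : ℕ) [NeZero L] [NeZero M] (G : GeoConsts) (P : SplitConsts) (Q : EngConsts) (β U μ : ℝ) (K : TrigPolyC4v) (n : ℕ),
      BetaSplitAtV17F L M G P Q β U μ n → PairVariationAtV17F L M G P Q β U μ n → Pr.split L M G P Q β U μ K n)
    (he : ∀ (L M : ℕ) [NeZero L] [NeZero M] (G : GeoConsts) (P : SplitConsts) (Q : EngConsts) (β U μ : ℝ) (K : TrigPolyC4v) (n : ℕ),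
      Pr.engine L M G P Q β U μ K n → EngineBoundsAtV17F2 L M G P Q β U μ n)
    (hr : ∀ (L M : ℕ) [NeZero L] [NeZero M] (β U μ : ℝ) (K : TrigPolyC4v) (R : RenConsts) (n : ℕ),
      Pr.renorm L M β U μ K R n → FlowPieceJetsAt L M β U μ R n) :
    BetaSplitP Pr W :=
  betaSplitP_of_slotsV17F2_variation (Pr := Pr) (fun L M _ _ G P Q β U μ K n hB hV => hs L M G P Q β U μ K n hB hV) he hr

end Summit.HubbardSuperconductivity.HubbardSuperconductivity.Theorems.KLRegimeSplit

end
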